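import Literature.MathematicalPhysics.KineticTheory.HardSphereEulerProofs
import HarnessLib

/-!
# `CollisionActivityTails` (stmt-AtomisticToContinuum-13734), line `SketchK1`: endpoint tails

Helper file (`--supports stmt-AtomisticToContinuum-13734`) for the crux
`Summit.AtomisticToContinuum.HydrodynamicLimit.Theses.OneFlightGossipEngine.CollisionActivityTails`
(shared with `…Theses.TwoClocks.CollisionActivityTails`), skeleton line `SketchK1`, registered stub
`stub_endpointTails`.

The line dominates the window collisional activity `a_i` of a tagged sphere by three functionals,
`a_i ≤ F¹_i + C (F²_i + Fcr_i)`; this file closes the ENDPOINT branch. From the two neighbouring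
statements of the line, taken as hypotheses,

* `EndpointKinematics` — the deterministic bound `Σ_i (F¹_i)² ≤ K (σ/τ)² E(z)` on the good set of
  the flow (`E = configEnergy`), and
* `MeanEnergyBound` — `∫ E dλ_N ≤ e₀ (N + 1)` under the local Gibbs law `λ_N`,

Chebyshev's inequality in the pointwise form `𝟙{V < F} F ≤ F² / V` (`tailFn_le_sq_div`) gives
`∫ (N+1)⁻¹ Σ_i 𝟙{V < F¹_i} F¹_i dλ_N ≤ K σ² e₀ / (τ² V) ≤ ε` as soon as
`τ ≥ τ₀ = √(K σ² e₀ / (V ε)) + 1`, uniformly in `N`, in the flow and in the window start `s`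
(`stub_endpointTails`). The good set carries the local Gibbs law because the law is absolutely
continuous with respect to the Liouville measure (`ae_mem_good_localGibbsLaw`). The file also
proves the measurability of the tail sum (`measurable_relMomentumNear`, `measurable_endpointTerm`):
the near-field relative momentum is a finite sum of `ite`s, over the measurable events
`{dist_{𝕋³}(x_j, x_i) ≤ r}` (`Torus.measurable_geometry_sepVec`), of continuous functions of the
velocities, composed with the measurable time-`t` maps of the flow.

References: the Chebyshev–Markov inequality is folklore; H. Spohn, *Large Scale Dynamics of
Interacting Particles* (1991), Part I §2.3 for the local Gibbs states.
-/

noncomputable section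

open MeasureTheory Set Filter Topology
open scoped ENNReal

namespace Summit.AtomisticToContinuum.HydrodynamicLimit.Theorems.CollisionActivityTailsEndpointTails

open Literature.MathematicalPhysics.KineticTheory Literature.Analysis.FluidPDE

/-! ## Vocabulary of the line (verbatim from the skeleton `SketchK1`) -/

/-- A hard-sphere flow of `N + 1` spheres of reduced diameter `σ` on `𝕋³` (the crux's `Φ N`). -/
abbrev Flow (σ : ℝ) (N : ℕ) : Type :=
  HardSphereFlow (Torus.geometry (Fin 3)) (hsDiameter σ N) (N + 1)

/-- Phase space of `N + 1` spheres on `𝕋³`. -/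
abbrev Cfg (N : ℕ) : Type := Config (N + 1) (Fin 3) T3

/-- The crux's window `w_N = τ (N+1)^{-1/3}`. -/
def window (τ : ℝ) (N : ℕ) : ℝ := τ * ((N : ℝ) + 1) ^ (-(1 / 3 : ℝ))

/-- The scalar tail functional `y ↦ 𝟙{V < y} y` (the crux's integrand is `(N+1)⁻¹ Σ_i tailFn V (a_i)`). -/
def tailFn (V y : ℝ) : ℝ := Set.indicator {y : ℝ | V < y} (fun y => y) y

/-- Minimal-image distance of two points of `𝕋³` (norm of the torus geometry's separation vector). -/
def tdist (x y : T3) : ℝ := ‖(Torus.geometry (Fin 3)).sepVec x y‖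

/-- Near-field relative momentum at `i`: `Σ_{j ≠ i, dist(x_j, x_i) ≤ r} |v_j − v_i|`. -/
def relMomentumNear {N : ℕ} (z : Cfg N) (i : Fin (N + 1)) (r : ℝ) : ℝ :=
  ∑ j : Fin (N + 1), if j ≠ i ∧ tdist (z j).1 (z i).1 ≤ r then ‖(z j).2 - (z i).2‖ else 0

/-- `F¹_i`: ENDPOINT TERM — `(σ/τ) ×` the near-field (radius `2ε`) relative momentum at `i` at the two endpoint times
of the window (the boundary values `|G_i(s)|, |G_i(s+w)| ≤ 2ε P_i` of the co-moving virial, in activity units). -/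
def endpointTerm {σ : ℝ} {N : ℕ} (Φ : Flow σ N) (τ s : ℝ) (i : Fin (N + 1)) (z : Cfg N) : ℝ :=
  σ / τ * (relMomentumNear (Φ.flow s z) i (2 * hsDiameter σ N) +
    relMomentumNear (Φ.flow (s + window τ N) z) i (2 * hsDiameter σ N))

/-- **ENDPOINT KINEMATICS** (deterministic; stub 2). There is an absolute constant `K` such that for
`0 < σ ≤ 1/8`, every `N`, flow, `τ > 0`, `s` and every good datum `z`:
`Σ_i (F¹_i)² ≤ K (σ/τ)² E(z)`, `E = configEnergy` (hard-core packing: at most `K₀` centres within `2ε` of a centre;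
Cauchy–Schwarz `P_i² ≤ K₀ Σ_{near} |v_j − v_i|² ≤ 2K₀ (Σ_{near}|v_j|² + K₀|v_i|²)`; each `j` is near at most `K₀`
centres; energy conservation `E(Φ_t z) = E(z)` on the good set). -/
def EndpointKinematics : Prop :=
  ∃ K : ℝ, 0 < K ∧ ∀ (σ : ℝ), 0 < σ → σ ≤ 1 / 8 → ∀ (N : ℕ) (Φ : Flow σ N) (τ : ℝ), 0 < τ →
    ∀ (s : ℝ), ∀ z ∈ Φ.good,
      ∑ i : Fin (N + 1), (endpointTerm Φ τ s i z) ^ 2 ≤ K * (σ / τ) ^ 2 * configEnergy z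

/-- **MEAN ENERGY BOUND** (statics of the local Gibbs law; stub 3). For continuous profiles the mean kinetic energy per
particle under the local Gibbs law is bounded uniformly in `N` and `σ ≤ 1/2` (Gaussian velocity marginal:
`E|v_i|² = |u₀(x_i)|² + 3 θ₀(x_i) ≤ sup |u₀|² + 3 sup θ₀`; the law is the zero measure when the spheres do not fit). -/
def MeanEnergyBound : Prop :=
  ∀ (a₀ θ₀ : T3 → ℝ) (u₀ : T3 → V3), Continuous a₀ → Continuous θ₀ → Continuous u₀ →
    (∀ x, 0 < a₀ x) → (∀ x, 0 < θ₀ x) → ∃ e₀ : ℝ, 0 < e₀ ∧ ∀ (σ : ℝ), 0 < σ → σ ≤ 1 / 2 →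
    ∀ (N : ℕ) (Φ : Flow σ N),
      ∫⁻ z, ENNReal.ofReal (configEnergy z) ∂(localGibbsLaw σ a₀ u₀ θ₀ N Φ) ≤
        ENNReal.ofReal (e₀ * ((N : ℝ) + 1))

/-- **ENDPOINT TAILS** (stub 4, from stubs 2 and 3 by Chebyshev `tailFn V F ≤ F²/V`): the `L¹` tail of `F¹` above ANY
level `V > 0` is at most `K σ² e₀ / (τ² V)`, uniformly in `N`, the flow and the window start — so it vanishes as
`τ → ∞` at fixed `V` (the crux shape, with `V₀` arbitrary and no `N₀`). Includes the measurability of the tail sum. -/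
def EndpointTails : Prop :=
  ∀ (a₀ θ₀ : T3 → ℝ) (u₀ : T3 → V3), Continuous a₀ → Continuous θ₀ → Continuous u₀ →
    (∀ x, 0 < a₀ x) → (∀ x, 0 < θ₀ x) → ∃ σ₀ : ℝ, 0 < σ₀ ∧ ∀ σ : ℝ, 0 < σ → σ < σ₀ →
    ∀ V : ℝ, 0 < V → ∀ ε : ℝ, 0 < ε → ∃ τ₀ : ℝ, 0 < τ₀ ∧ ∀ τ : ℝ, τ₀ ≤ τ →
    ∀ (N : ℕ) (Φ : Flow σ N) (s : ℝ),
      AEMeasurable (fun z => ∑ i : Fin (N + 1), tailFn V (endpointTerm Φ τ s i z))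
          (localGibbsLaw σ a₀ u₀ θ₀ N Φ) ∧
      ∫⁻ z, ENNReal.ofReal (((N : ℝ) + 1)⁻¹ * ∑ i : Fin (N + 1), tailFn V (endpointTerm Φ τ s i z))
        ∂(localGibbsLaw σ a₀ u₀ θ₀ N Φ) ≤ ENNReal.ofReal ε

/-! ## The scalar tail functional: pointwise Chebyshev -/

/-- On the tail `V < y` the functional is the identity. -/
theorem tailFn_of_lt {V y : ℝ} (h : V < y) : tailFn V y = y :=
  Set.indicator_of_mem (show y ∈ {y : ℝ | V < y} from h) _

/-- Off the tail (`y ≤ V`) the functional vanishes. -/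
theorem tailFn_of_le {V y : ℝ} (h : y ≤ V) : tailFn V y = 0 :=
  Set.indicator_of_notMem (show y ∉ {y : ℝ | V < y} from fun h' => (not_lt.2 h) h') _

/-- **Pointwise Chebyshev.** Above a positive level `V`, `𝟙{V < y} y ≤ y² / V`
(on the tail `y = y · y / y ≤ y · y / V` since `y > V > 0`; off the tail `0 ≤ y² / V`). -/
theorem tailFn_le_sq_div {V : ℝ} (hV : 0 < V) (y : ℝ) : tailFn V y ≤ y ^ 2 / V := by
  by_cases h : V < y
  · rw [tailFn_of_lt h, le_div_iff₀ hV, sq]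
    exact mul_le_mul_of_nonneg_left h.le (hV.trans h).le
  · rw [tailFn_of_le (not_lt.1 h)]
    positivity

/-! ## Measurability of the endpoint tail sum -/

/-- `tailFn V` is measurable (indicator of the measurable set `{V < ·}` applied to the identity). -/
theorem measurable_tailFn (V : ℝ) : Measurable (tailFn V) :=
  measurable_id.indicator (measurableSet_lt measurable_const measurable_id)

/-- The minimal-image distance of two centres is a measurable function of the configuration. -/
theorem measurable_tdist {N : ℕ} (j i : Fin (N + 1)) :
    Measurable fun z : Cfg N => tdist (z j).1 (z i).1 :=
  (Torus.measurable_geometry_sepVec.comp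
    ((measurable_pi_apply j).fst.prodMk (measurable_pi_apply i).fst)).norm

/-- The near-field relative momentum at `i` is a measurable function of the configuration: a finite
sum of `ite`s over the measurable events `{j ≠ i ∧ dist(x_j, x_i) ≤ r}` of the continuous functions
`|v_j − v_i|`. -/
theorem measurable_relMomentumNear {N : ℕ} (i : Fin (N + 1)) (r : ℝ) :
    Measurable fun z : Cfg N => relMomentumNear z i r := by
  unfold relMomentumNear
  refine Finset.measurable_sum _ fun j _ => Measurable.ite ?_ ?_ measurable_const
  · exact (MeasurableSet.const (j ≠ i)).inter
      (measurableSet_le (measurable_tdist j i) measurable_const)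
  · exact ((measurable_pi_apply j).snd.sub (measurable_pi_apply i).snd).norm

/-- The endpoint term `F¹_i` is a measurable function of the initial datum (the time-`t` maps of the
flow are measurable). -/
theorem measurable_endpointTerm {σ : ℝ} {N : ℕ} (Φ : Flow σ N) (τ s : ℝ) (i : Fin (N + 1)) :
    Measurable fun z : Cfg N => endpointTerm Φ τ s i z := by
  unfold endpointTerm
  exact (((measurable_relMomentumNear i _).comp (Φ.measurable_flow s)).add
    ((measurable_relMomentumNear i _).comp (Φ.measurable_flow _))).const_mul _

/-- The tail sum `Σ_i 𝟙{V < F¹_i} F¹_i` of the endpoint terms is a measurable function of the initial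
datum. -/
theorem measurable_sum_tailFn_endpointTerm {σ : ℝ} {N : ℕ} (Φ : Flow σ N) (τ s V : ℝ) :
    Measurable fun z : Cfg N => ∑ i : Fin (N + 1), tailFn V (endpointTerm Φ τ s i z) :=
  Finset.measurable_sum _ fun i _ => (measurable_tailFn V).comp (measurable_endpointTerm Φ τ s i)

/-! ## The `lintegral` bookkeeping -/

/-- Under the local Gibbs law almost every datum is good (the law is absolutely continuous with respect to the
Liouville measure, whose complement of the good set is null). -/
theorem ae_mem_good_localGibbsLaw (σ : ℝ) (a₀ θ₀ : T3 → ℝ) (u₀ : T3 → V3) (N : ℕ) (Φ : Flow σ N) :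
    ∀ᵐ z ∂(localGibbsLaw σ a₀ u₀ θ₀ N Φ), z ∈ Φ.good := by
  have hac : localGibbsLaw σ a₀ u₀ θ₀ N Φ ≪ liouville (Torus.geometry (Fin 3)) (N + 1) (hsDiameter σ N) := by
    rw [localGibbsLaw_eq]
    exact localGibbsMeasure_absolutelyContinuous σ a₀ u₀ θ₀ N Φ
  exact hac.ae_le Φ.ae_mem_good

/-- The `lintegral` Chebyshev step: if `h ≤ c g` almost everywhere with `c ≥ 0` and
`∫⁻ ofReal g ≤ ofReal B`, then `∫⁻ ofReal h ≤ ofReal (c B)` (no measurability needed). -/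
theorem lintegral_ofReal_le_of_le_mul {α : Type*} [MeasurableSpace α] {μ : Measure α}
    {h g : α → ℝ} {c B : ℝ} (hc : 0 ≤ c) (hle : ∀ᵐ x ∂μ, h x ≤ c * g x)
    (hb : ∫⁻ x, ENNReal.ofReal (g x) ∂μ ≤ ENNReal.ofReal B) :
    ∫⁻ x, ENNReal.ofReal (h x) ∂μ ≤ ENNReal.ofReal (c * B) := by
  calc ∫⁻ x, ENNReal.ofReal (h x) ∂μ
      ≤ ∫⁻ x, ENNReal.ofReal c * ENNReal.ofReal (g x) ∂μ := by
        refine lintegral_mono_ae (hle.mono fun x hx => ?_)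
        rw [← ENNReal.ofReal_mul hc]
        exact ENNReal.ofReal_le_ofReal hx
    _ = ENNReal.ofReal c * ∫⁻ x, ENNReal.ofReal (g x) ∂μ :=
        lintegral_const_mul' _ _ ENNReal.ofReal_ne_top
    _ ≤ ENNReal.ofReal c * ENNReal.ofReal B := mul_le_mul_right hb _
    _ = ENNReal.ofReal (c * B) := (ENNReal.ofReal_mul hc).symm

/-- Pointwise step on a good datum: averaging the pointwise Chebyshev bound over the particles and
inserting the endpoint kinematics bound gives
`(N+1)⁻¹ Σ_i 𝟙{V < F¹_i} F¹_i ≤ (N+1)⁻¹ (K (σ/τ)² / V) · E(z)`. -/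
theorem avgTail_endpointTerm_le {σ : ℝ} {N : ℕ} (Φ : Flow σ N) {τ s V K : ℝ} (hV : 0 < V)
    {z : Cfg N}
    (hz : ∑ i : Fin (N + 1), (endpointTerm Φ τ s i z) ^ 2 ≤ K * (σ / τ) ^ 2 * configEnergy z) :
    ((N : ℝ) + 1)⁻¹ * ∑ i, tailFn V (endpointTerm Φ τ s i z) ≤
      ((N : ℝ) + 1)⁻¹ * (K * (σ / τ) ^ 2 / V) * configEnergy z := by
  have hN : (0 : ℝ) ≤ ((N : ℝ) + 1)⁻¹ := by positivity
  calc ((N : ℝ) + 1)⁻¹ * ∑ i, tailFn V (endpointTerm Φ τ s i z)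
      ≤ ((N : ℝ) + 1)⁻¹ * ∑ i, (endpointTerm Φ τ s i z) ^ 2 / V :=
        mul_le_mul_of_nonneg_left (Finset.sum_le_sum fun i _ => tailFn_le_sq_div hV _) hN
    _ = ((N : ℝ) + 1)⁻¹ * ((∑ i, (endpointTerm Φ τ s i z) ^ 2) / V) := by rw [Finset.sum_div]
    _ ≤ ((N : ℝ) + 1)⁻¹ * (K * (σ / τ) ^ 2 * configEnergy z / V) :=
        mul_le_mul_of_nonneg_left (div_le_div_of_nonneg_right hz hV.le) hN
    _ = ((N : ℝ) + 1)⁻¹ * (K * (σ / τ) ^ 2 / V) * configEnergy z := by ring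

/-! ## The stub -/

/-- **STUB 4 of line `SketchK1` (endpoint tails).** From the endpoint kinematics bound
`Σ_i (F¹_i)² ≤ K (σ/τ)² E(z)` on the good set and the mean energy bound `∫ E dλ_N ≤ e₀ (N+1)`,
Chebyshev gives, for every level `V > 0` and accuracy `ε > 0`, a window threshold
`τ₀ = √(K σ² e₀ / (V ε)) + 1` beyond which `∫ (N+1)⁻¹ Σ_i 𝟙{V < F¹_i} F¹_i dλ_N ≤ K σ² e₀ /(τ² V) ≤ ε`
for every `N`, every flow and every window start; `σ₀ = 1/8`. The tail sum is measurable. -/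
theorem stub_endpointTails : EndpointKinematics → MeanEnergyBound → EndpointTails := by
  rintro ⟨K, hK0, hK⟩ hE a₀ θ₀ u₀ ha hθ hu ha0 hθ0
  obtain ⟨e₀, he₀, hE⟩ := hE a₀ θ₀ u₀ ha hθ hu ha0 hθ0
  refine ⟨1 / 8, by norm_num, ?_⟩
  intro σ hσ hσ8 V hV ε hε
  have hσ8' : σ ≤ 1 / 8 := hσ8.le
  have hσ2 : σ ≤ 1 / 2 := by linarith
  -- the window threshold `τ₀ = √A + 1`, `A = K σ² e₀ / (V ε)`
  set A : ℝ := K * σ ^ 2 * e₀ / (V * ε) with hA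
  have hA0 : 0 ≤ A := by positivity
  refine ⟨Real.sqrt A + 1, by positivity, ?_⟩
  intro τ hτ N Φ s
  have hτpos : 0 < τ := by linarith [Real.sqrt_nonneg A]
  have hτA : A ≤ τ ^ 2 := by
    have h1 : Real.sqrt A ≤ τ := by linarith
    calc A = Real.sqrt A ^ 2 := (Real.sq_sqrt hA0).symm
      _ ≤ τ ^ 2 := pow_le_pow_left₀ (Real.sqrt_nonneg A) h1 2
  refine ⟨(measurable_sum_tailFn_endpointTerm Φ τ s V).aemeasurable, ?_⟩
  -- the constant in front of the energy and its price
  set c : ℝ := ((N : ℝ) + 1)⁻¹ * (K * (σ / τ) ^ 2 / V) with hc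
  have hc0 : 0 ≤ c := by positivity
  have hcε : c * (e₀ * ((N : ℝ) + 1)) ≤ ε := by
    have hN : (N : ℝ) + 1 ≠ 0 := by positivity
    have hτ0 : τ ≠ 0 := hτpos.ne'
    have hV0 : V ≠ 0 := hV.ne'
    have hε0 : ε ≠ 0 := hε.ne'
    have hmain : K * σ ^ 2 * e₀ ≤ τ ^ 2 * (V * ε) := (div_le_iff₀ (by positivity)).1 hτA
    have h1 : c * (e₀ * ((N : ℝ) + 1)) = K * σ ^ 2 * e₀ / (τ ^ 2 * V) := by
      rw [hc]
      field_simp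
    rw [h1, div_le_iff₀ (by positivity)]
    calc K * σ ^ 2 * e₀ ≤ τ ^ 2 * (V * ε) := hmain
      _ = ε * (τ ^ 2 * V) := by ring
  -- pointwise Chebyshev on the good set, which carries the law
  have hle : ∀ᵐ z ∂(localGibbsLaw σ a₀ u₀ θ₀ N Φ),
      ((N : ℝ) + 1)⁻¹ * ∑ i, tailFn V (endpointTerm Φ τ s i z) ≤ c * configEnergy z := by
    filter_upwards [ae_mem_good_localGibbsLaw σ a₀ θ₀ u₀ N Φ] with z hz
    exact avgTail_endpointTerm_le Φ hV (hK σ hσ hσ8' N Φ τ hτpos s z hz)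
  exact (lintegral_ofReal_le_of_le_mul hc0 hle (hE σ hσ hσ2 N Φ)).trans
    (ENNReal.ofReal_le_ofReal hcε)

end Summit.AtomisticToContinuum.HydrodynamicLimit.Theorems.CollisionActivityTailsEndpointTails

end
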